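import Summits.NavierStokesRegularity.FluidComputer.RowSegment
import HarnessLib

/-!
# `RowSwitchEq`: the hand-over at an EQUAL-PHASE switch of the row chain (a frame re-selection with the
# same lock coordinate, e.g. the regime switch `973|974` of the row chain of record (k53d; also of k52); `pub-fluidc-bp3/R1-DESIGN.md`
# §7.4 "regime switches … are frame changes at equal phase (Δs = 0)", §8.8 (3) layer B′)

HONEST FRAMING (cell `pub-fluidc`, blueprint seat bp3, gen 21): low prior, high value-of-information
experiment on Tao's machine paradigm; NOT a claim that NS blows up. Pure linear algebra, no fluid
mechanics: at a switch `r | r'` with the SAME lock coordinate `p' = p` (and the same `P`, the reference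
point continued exactly) no re-synchronisation of the member's phase is needed, so the new row's frame
coordinates at its start are `z' = A₀'[1:] e` with `e` the old row's deviation at its end; writing
`e = T̂₁[:,1:] z + (I − T̂₁[:,1:] A₁[1:,:]) e` (an identity — no inverse is needed) with `|z| ≤ u_next`
(`RowData.row_end`) and `|e| ≤ Ē` gives `|z'ᵢ| ≤ Σⱼ |M1ᵢⱼ| u_next,j + Σₖ |M2ᵢₖ| Ēₖ` with the EXACT RATIONAL
matrices `M1 = A₀'[1:] T̂₁[:,1:]`, `M2 = A₀'[1:] (I − T̂₁[:,1:] A₁[1:,:])` of the canonical (lower-endpoint)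
frames. `swEqOK r r'` decides this against the new start box `u'`; `switchEq_hu0` is its soundness: the
`hu0` hypothesis of the new row. (The kernel of record bounds the same quantity in interval arithmetic
plus a second-order term that vanishes here; the exact check is at least as sharp.) The two STAGE
switches `656|657`, `986|987` (new lock coordinate, a genuine re-timing) are NOT covered by this file.

[cite: Tao2016AveragedNS, §5.5 Thm 5.3 (5.5)]
-/

namespace Summit.NavierStokesRegularity.FluidComputer

open Literature.Analysis.FluidPDE.FluidComputer

namespace RowCheck

open DIVec ChainField Finset Real Set Matrix

/-- The lower-endpoint matrix of an interval table as exact rationals `lo/2^P`. [folklore] -/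
def loQ (P : ℕ) (M : Fin 9 → Fin 9 → DI) (i j : Fin 9) : ℚ := ((M i j).lo : ℚ) / 2 ^ P

/-- [folklore] -/
theorem loM_eq_cast (P : ℕ) (M : Fin 9 → Fin 9 → DI) (i j : Fin 9) :
    loM P M i j = ((loQ P M i j : ℚ) : ℝ) := by
  simp only [loM, loQ]; push_cast; rfl

namespace RowData

variable {r r' : RowData}

/-! ### The exact transfer matrices and the decided check -/

/-- `M1 = A₀'[1:] · T̂₁[:,1:]` (8 × 8, exact rationals). [folklore] -/
def swM1 (r r' : RowData) (i j : Fin 8) : ℚ :=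
  ∑ a : Fin 9, loQ r'.P r'.A0I i.succ a * loQ r.P r.T1I a j.succ

/-- `M2 = A₀'[1:] · (I − T̂₁[:,1:] A₁[1:,:])` (8 × 9, exact rationals). [folklore] -/
def swM2 (r r' : RowData) (i : Fin 8) (k : Fin 9) : ℚ :=
  ∑ a : Fin 9, loQ r'.P r'.A0I i.succ a *
    ((if a = k then 1 else 0) - ∑ j : Fin 8, loQ r.P r.T1I a j.succ * loQ r.P r.A1I j.succ k)

/-- The equal-phase switch check, reading the old row's end box off an evaluated `uNext`: same `P`, same
lock coordinate, reference point continued exactly, and `|M1| u_next + |M2| Ē ≤ u'` slot-wise (integer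
tables; all carry the common scale `2^P`). [folklore] -/
def swEqOn (r : RowData) (un : Vec ℤ 8) (r' : RowData) : Bool :=
  decide (r'.P = r.P) && decide (r'.p = r.p) &&
  decide (∀ a : Fin 9, evalQ (r'.CQ a) 0 = evalQ (r.CQ a) r.Hq) &&
  decide (∀ i : Fin 8, ∑ j : Fin 8, |swM1 r r' i j| * (un.get j : ℚ) +
    ∑ k : Fin 9, |swM2 r r' i k| * (r.Eb k : ℚ) ≤ (r'.u i.succ : ℚ))

/-- **The equal-phase switch check** `r | r'`. [folklore] -/
def swEqOK (r r' : RowData) : Bool := swEqOn r r.rowCheck.uNext r'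

/-- [folklore] -/
theorem swEqOK_iff : swEqOK r r' = true ↔ r'.P = r.P ∧ r'.p = r.p ∧
    (∀ a : Fin 9, evalQ (r'.CQ a) 0 = evalQ (r.CQ a) r.Hq) ∧
    (∀ i : Fin 8, ∑ j : Fin 8, |swM1 r r' i j| * (r.rowCheck.uNext.get j : ℚ) +
      ∑ k : Fin 9, |swM2 r r' i k| * (r.Eb k : ℚ) ≤ (r'.u i.succ : ℚ)) := by
  simp only [swEqOK, swEqOn, Bool.and_eq_true, decide_eq_true_eq, and_assoc]

/-! ### Soundness -/

/-- The transfer identity `A₀'[1:] e = M1 z + M2 e` for `z = A₁[1:,:] e` (pure algebra). [folklore] -/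
theorem transfer_identity (A0' T1 A1 : Matrix (Fin 9) (Fin 9) ℝ) (e : Fin 9 → ℝ) (i : Fin 8) :
    ∑ a : Fin 9, A0' i.succ a * e a =
      ∑ j : Fin 8, (∑ a : Fin 9, A0' i.succ a * T1 a j.succ) * (∑ k : Fin 9, A1 j.succ k * e k) +
      ∑ k : Fin 9, (∑ a : Fin 9, A0' i.succ a *
        ((if a = k then 1 else 0) - ∑ j : Fin 8, T1 a j.succ * A1 j.succ k)) * e k := by
  let A : Matrix (Fin 8) (Fin 9) ℝ := fun i a => A0' i.succ a
  let T : Matrix (Fin 9) (Fin 8) ℝ := fun a j => T1 a j.succ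
  let B : Matrix (Fin 8) (Fin 9) ℝ := fun j k => A1 j.succ k
  have hmat : A *ᵥ e = (A * T) *ᵥ (B *ᵥ e) + (A * (1 - T * B)) *ᵥ e := by
    rw [Matrix.mulVec_mulVec, Matrix.mul_sub, Matrix.mul_one, Matrix.sub_mulVec, ← Matrix.mul_assoc]
    abel
  have h := congrFun hmat i
  simp only [Matrix.mulVec, dotProduct, Pi.add_apply, Matrix.mul_apply, Matrix.sub_apply,
    Matrix.one_apply, A, T, B] at h
  exact h

/-- [folklore] -/
theorem abs_sum_mul_le {n : ℕ} (c x B : Fin n → ℝ) (h : ∀ j, |x j| ≤ B j) :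
    |∑ j, c j * x j| ≤ ∑ j, |c j| * B j :=
  (Finset.abs_sum_le_sum_abs _ _).trans
    (Finset.sum_le_sum fun j _ => by rw [abs_mul]; exact mul_le_mul_of_nonneg_left (h j) (abs_nonneg _))

/-- **Soundness of the equal-phase switch check**: if `swEqOK r r'`, the old row's model has its frame
coordinates in the end box `u_next` and its deviation in `Ē` at `T₀ + H`, then the new row's model
(canonical frames, started at `T₀ + H` with the same member data) has its frame coordinates in the new
start box `u'` there — the `hu0` hypothesis of the new row. [folklore] -/
theorem switchEq_hu0 (hs : swEqOK r r' = true) (h : r.framesOK = true) (h' : r'.framesOK = true)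
    (G : r.GateOK) (G' : r'.GateOK) (T0 : ℝ) (m : MemberData) (hH : (r.Hq : ℝ) ≠ 0)
    (hz : ∀ i, |(toModel (canon h) G T0 m).z (T0 + r.Hq) i| ≤ r.ubR (2 ^ r.msub) i)
    (he : ∀ a, |(toModel (canon h) G T0 m).e (T0 + r.Hq) a| ≤ r.EbarR a) :
    ∀ i, |(toModel (canon h') G' (T0 + r.Hq) m).z (T0 + r.Hq) i| ≤ r'.ubR 0 i := by
  obtain ⟨hP, -, hx, hineq⟩ := swEqOK_iff.mp hs
  set R := toModel (canon h) G T0 m with hR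
  set R' := toModel (canon h') G' (T0 + r.Hq) m with hR'
  -- the new model's deviation at its start is the old model's deviation at its end
  have hee : R'.e (T0 + r.Hq) = R.e (T0 + r.Hq) := by
    ext a
    simp only [hR, hR', RowModel.e, toModel, sub_self, add_sub_cancel_left]
    rw [show (0 : ℝ) = ((0 : ℚ) : ℝ) by simp, xh_ratCast, xh_ratCast, hx a]
  -- frames at the junction: new `A₀'`, old `A₁`
  have hAm' : ∀ i a, R'.Am (T0 + r.Hq) i a = ((loQ r'.P r'.A0I i.succ a : ℚ) : ℝ) := by
    intro i a
    simp only [hR', toModel, sub_self, zero_div, Av_zero, canon, loM_eq_cast]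
  have hAm : ∀ j k, R.Am (T0 + r.Hq) j k = ((loQ r.P r.A1I j.succ k : ℚ) : ℝ) := by
    intro j k
    simp only [hR, toModel, add_sub_cancel_left, div_self hH, Av_one, canon, loM_eq_cast]
  intro i
  have hz' : R'.z (T0 + r.Hq) i = ∑ a : Fin 9, ((loQ r'.P r'.A0I i.succ a : ℚ) : ℝ) * R.e (T0 + r.Hq) a := by
    simp only [RowModel.z, Matrix.mulVec, dotProduct, hee, hAm']
  have hzj : ∀ j : Fin 8, R.z (T0 + r.Hq) j =
      ∑ k : Fin 9, ((loQ r.P r.A1I j.succ k : ℚ) : ℝ) * R.e (T0 + r.Hq) k := by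
    intro j; simp only [RowModel.z, Matrix.mulVec, dotProduct, hAm]
  rw [hz', transfer_identity (fun i a => ((loQ r'.P r'.A0I i a : ℚ) : ℝ))
    (fun a j => ((loQ r.P r.T1I a j : ℚ) : ℝ)) (fun j k => ((loQ r.P r.A1I j k : ℚ) : ℝ))]
  simp only [← hzj]
  -- the two sums, bounded by the boxes
  have hub : ∀ j : Fin 8, |R.z (T0 + r.Hq) j| ≤ ((r.rowCheck.uNext.get j : ℚ) : ℝ) / 2 ^ r.P := by
    intro j
    have := hz j
    rw [ubR, ← uNext_eq, toR] at this
    exact_mod_cast this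
  have heb : ∀ k : Fin 9, |R.e (T0 + r.Hq) k| ≤ ((r.Eb k : ℚ) : ℝ) / 2 ^ r.P := by
    intro k
    have := he k
    rw [EbarR, toR] at this
    exact_mod_cast this
  have h1 := abs_sum_mul_le (fun j : Fin 8 => ((swM1 r r' i j : ℚ) : ℝ)) (fun j => R.z (T0 + r.Hq) j)
    (fun j => ((r.rowCheck.uNext.get j : ℚ) : ℝ) / 2 ^ r.P) hub
  have h2 := abs_sum_mul_le (fun k : Fin 9 => ((swM2 r r' i k : ℚ) : ℝ)) (fun k => R.e (T0 + r.Hq) k)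
    (fun k => ((r.Eb k : ℚ) : ℝ) / 2 ^ r.P) heb
  have hM1 : ∀ j : Fin 8, (∑ a : Fin 9, ((loQ r'.P r'.A0I i.succ a : ℚ) : ℝ) *
      ((loQ r.P r.T1I a j.succ : ℚ) : ℝ)) = ((swM1 r r' i j : ℚ) : ℝ) := by
    intro j; simp only [swM1]; push_cast; rfl
  have hM2 : ∀ k : Fin 9, (∑ a : Fin 9, ((loQ r'.P r'.A0I i.succ a : ℚ) : ℝ) *
      ((if a = k then 1 else 0) - ∑ j : Fin 8, ((loQ r.P r.T1I a j.succ : ℚ) : ℝ) *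
        ((loQ r.P r.A1I j.succ k : ℚ) : ℝ))) = ((swM2 r r' i k : ℚ) : ℝ) := by
    intro k; simp only [swM2]; push_cast
    refine Finset.sum_congr rfl fun a _ => ?_
    split_ifs <;> simp
  simp only [hM1, hM2]
  have hq : ((∑ j : Fin 8, |swM1 r r' i j| * (r.rowCheck.uNext.get j : ℚ) +
      ∑ k : Fin 9, |swM2 r r' i k| * (r.Eb k : ℚ) : ℚ) : ℝ) ≤ ((r'.u i.succ : ℚ) : ℝ) := by
    exact_mod_cast hineq i
  have hP0 : (0 : ℝ) < 2 ^ r.P := by positivity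
  rw [ubR_zero, toR, hP]
  calc |_| ≤ _ := abs_add_le _ _
    _ ≤ (∑ j : Fin 8, |((swM1 r r' i j : ℚ) : ℝ)| * (((r.rowCheck.uNext.get j : ℚ) : ℝ) / 2 ^ r.P)) +
        ∑ k : Fin 9, |((swM2 r r' i k : ℚ) : ℝ)| * (((r.Eb k : ℚ) : ℝ) / 2 ^ r.P) := add_le_add h1 h2
    _ = ((∑ j : Fin 8, |swM1 r r' i j| * (r.rowCheck.uNext.get j : ℚ) +
        ∑ k : Fin 9, |swM2 r r' i k| * (r.Eb k : ℚ) : ℚ) : ℝ) / 2 ^ r.P := by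
      push_cast; simp only [Finset.sum_div, add_div]; refine congrArg₂ _ ?_ ?_ <;>
        refine Finset.sum_congr rfl fun _ _ => ?_ <;> ring
    _ ≤ ((r'.u i.succ : ℚ) : ℝ) / 2 ^ r.P := div_le_div_of_nonneg_right hq hP0.le
    _ = ((r'.u i.succ : ℤ) : ℝ) / 2 ^ r.P := by norm_cast

end RowData

end RowCheck

end Summit.NavierStokesRegularity.FluidComputer
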